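import Summits.BirchSwinnertonDyer.Rank1Residual.X4.KuriharaAdditiveLevelLowering
import HarnessLib

/-!
# The Hecke transforms `H_q`, `H_{q'}` COMMUTE on periodic functions, and so do the derivatives `d_q = H_q − 2` (cell `b2b-bsdres`, seat additive-p4 gen 30, line V51′ — first brick of lemma S: derivative families generated by one function)

HONEST FRAMING (verbatim, cell `b2b-bsdres`): the goal of the cell is to DELETE the COMBINATION-SHAPED
residual classes for ALL analytic-rank `≤ 1` curves over `ℚ` — "full BSD formula for every rank `≤ 1`
curve in class `C`" assembled STRICTLY from published theorems — so that the rank-`≤ 1` remainder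
becomes exactly the CONSTRUCTION-SHAPED classes, which are TYPED (missing-input Props), NOT attempted;
this is not "finishing BSD". This file: research-route KERNEL LEMMAS (pure algebra; no named fact, no
conjecture, nothing booked; X4 stays CONSTRUCTION-SHAPED).

## What is proved (and why)

The two-prime additivity theorem (`X4/KuriharaAdditiveLevelLowering.lean`) is proved modulo LEMMA S:
for the given level `n`, a DERIVATIVE FAMILY `G` (`H_q (G U) = 2·G U + G (U ∪ {q})`) whose non-empty
members have prescribed Kurihara numbers. Lemma S's witness is `G U = d_U γ := (∏_{q ∈ U} (H_q − 2)) γ`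
for an explicit periodic `γ`; for this to BE a family indexed by finite SETS the operators `d_q` must
commute on periodic functions and preserve periodicity. This file proves exactly that:

* `sum_range_comp_mul_mod` — for `c` prime to the prime `q` and `μ` periodic,
  `∑_{j<q} μ((s + c j)/q) = ∑_{j<q} μ((s + j)/q)`; `sum_range_comp_add_int` — the same with the shift
  `j ↦ t + j` (`t ∈ ℤ`); `sum_range_prod_eq` — the double sum `∑_{j<q} ∑_{j'<q'} μ((r + j + q j')/(qq'))`
  is the single sum over `c < qq'`.
* `IsPeriodic.heckeTransform'` — `H_q μ` is periodic; `heckeTransform_heckeTransform` — the closed form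
  of `H_q (H_{q'} μ)` for distinct primes; **`heckeTransform_comm`**.
* `heckeDeriv q μ = H_q μ − 2μ`; `IsPeriodic.heckeDeriv`; **`heckeDeriv_comm`**.

## References

* B. Mazur, J. Tate, J. Teitelbaum, Invent. Math. 84 (1986), §I.4 (4.2) (the formula for `T_q` on
  `{∞ → r}`; Hecke operators commute). [cite: MazurTateTeitelbaum1986Invent, §I.4 (4.2)]
-/

noncomputable section

open scoped MatrixGroups ModularForm

open CongruenceSubgroup Finset

open Literature.NumberTheory.EllipticCurves Literature.NumberTheory.EllipticCurves.ModularForms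

namespace Summit.BirchSwinnertonDyer.Rank1Residual.LevelLowering

variable {R : Type*} [CommRing R] {μ : ℚ → R}

/-! ### §1 Reindexing lemmas -/

/-- **Reindexing by a unit mod `q`**: for `c` prime to the prime `q` and `μ` periodic,
`∑_{j<q} μ((s + c j)/q) = ∑_{j<q} μ((s + j)/q)`. [folklore] -/
theorem sum_range_comp_mul_mod (hμ : IsPeriodic μ) {q c : ℕ} (hq : q.Prime) (hc : c.Coprime q)
    (s : ℚ) :
    ∑ j ∈ Finset.range q, μ ((s + c * j) / q) = ∑ j ∈ Finset.range q, μ ((s + j) / q) := by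
  have hq0 : 0 < q := hq.pos
  have hqQ : (q : ℚ) ≠ 0 := by exact_mod_cast hq.ne_zero
  have hmaps : ∀ j ∈ Finset.range q, c * j % q ∈ Finset.range q :=
    fun j _ ↦ Finset.mem_range.mpr (Nat.mod_lt _ hq0)
  have hinj : Set.InjOn (fun j ↦ c * j % q) (Finset.range q : Set ℕ) := by
    intro j₁ hj₁ j₂ hj₂ h
    have hj₁' : j₁ < q := Finset.mem_range.mp (Finset.mem_coe.mp hj₁)
    have hj₂' : j₂ < q := Finset.mem_range.mp (Finset.mem_coe.mp hj₂)
    have hmod : c * j₁ ≡ c * j₂ [MOD q] := h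
    have hcancel : j₁ ≡ j₂ [MOD q] :=
      Nat.ModEq.cancel_left_of_coprime (by simpa [Nat.coprime_comm] using hc) hmod
    exact Nat.ModEq.eq_of_lt_of_lt hcancel hj₁' hj₂'
  have hsurj : Set.SurjOn (fun j ↦ c * j % q) (Finset.range q : Set ℕ) (Finset.range q : Set ℕ) :=
    Finset.surjOn_of_injOn_of_card_le _ hmaps hinj le_rfl
  refine Finset.sum_nbij (fun j ↦ c * j % q) hmaps hinj hsurj fun j _ ↦ ?_
  have hdecomp : ((c * j % q : ℕ) : ℚ) = (c : ℚ) * j - (q : ℚ) * ((c * j / q : ℕ) : ℚ) := by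
    have h := Nat.mod_add_div (c * j) q
    have h' : ((c * j % q : ℕ) : ℚ) + (q : ℚ) * ((c * j / q : ℕ) : ℚ) = (c : ℚ) * j := by
      exact_mod_cast h
    linarith
  refine hμ.eq_of_eq_add_int ((c * j / q : ℕ) : ℤ) ?_
  rw [Int.cast_natCast, hdecomp]
  field_simp
  ring

/-- **Reindexing by a translation**: for a natural `b` and `μ` periodic,
`∑_{j<q} μ((s + (b + j))/q) = ∑_{j<q} μ((s + j)/q)` (`q > 0`). [folklore] -/
theorem sum_range_comp_add_nat (hμ : IsPeriodic μ) {q : ℕ} (hq : 0 < q) (b : ℕ) (s : ℚ) :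
    ∑ j ∈ Finset.range q, μ ((s + ((b + j : ℕ) : ℚ)) / q) = ∑ j ∈ Finset.range q, μ ((s + j) / q) := by
  have hqQ : (q : ℚ) ≠ 0 := by exact_mod_cast hq.ne'
  have hmaps : ∀ j ∈ Finset.range q, (b + j) % q ∈ Finset.range q :=
    fun j _ ↦ Finset.mem_range.mpr (Nat.mod_lt _ hq)
  have hinj : Set.InjOn (fun j ↦ (b + j) % q) (Finset.range q : Set ℕ) := by
    intro j₁ hj₁ j₂ hj₂ h
    have hj₁' : j₁ < q := Finset.mem_range.mp (Finset.mem_coe.mp hj₁)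
    have hj₂' : j₂ < q := Finset.mem_range.mp (Finset.mem_coe.mp hj₂)
    have hmod : b + j₁ ≡ b + j₂ [MOD q] := h
    exact Nat.ModEq.eq_of_lt_of_lt (Nat.ModEq.add_left_cancel' b hmod) hj₁' hj₂'
  have hsurj : Set.SurjOn (fun j ↦ (b + j) % q) (Finset.range q : Set ℕ) (Finset.range q : Set ℕ) :=
    Finset.surjOn_of_injOn_of_card_le _ hmaps hinj le_rfl
  refine Finset.sum_nbij (fun j ↦ (b + j) % q) hmaps hinj hsurj fun j _ ↦ ?_
  have hdecomp : (((b + j) % q : ℕ) : ℚ) = ((b + j : ℕ) : ℚ) - (q : ℚ) * (((b + j) / q : ℕ) : ℚ) := by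
    have h := Nat.mod_add_div (b + j) q
    have h' : (((b + j) % q : ℕ) : ℚ) + (q : ℚ) * (((b + j) / q : ℕ) : ℚ) = ((b + j : ℕ) : ℚ) := by
      exact_mod_cast h
    linarith
  refine hμ.eq_of_eq_add_int (((b + j) / q : ℕ) : ℤ) ?_
  rw [Int.cast_natCast, hdecomp]
  field_simp
  ring

/-- **Reindexing by an integer translation**: `∑_{j<q} μ((s + t + j)/q) = ∑_{j<q} μ((s + j)/q)` for
`t ∈ ℤ`, `μ` periodic, `q > 0`. [folklore] -/
theorem sum_range_comp_add_int (hμ : IsPeriodic μ) {q : ℕ} (hq : 0 < q) (t : ℤ) (s : ℚ) :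
    ∑ j ∈ Finset.range q, μ ((s + t + j) / q) = ∑ j ∈ Finset.range q, μ ((s + j) / q) := by
  have hqQ : (q : ℚ) ≠ 0 := by exact_mod_cast hq.ne'
  have hqZ : (q : ℤ) ≠ 0 := by exact_mod_cast hq.ne'
  -- `t = q·a + b` with `0 ≤ b < q`
  set a : ℤ := t / q with ha
  set b : ℕ := (t % q).toNat with hb
  have hb0 : 0 ≤ t % q := Int.emod_nonneg t hqZ
  have hbq : (b : ℤ) = t % q := Int.toNat_of_nonneg hb0
  have htab : (t : ℚ) = (q : ℚ) * a + (b : ℕ) := by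
    have h := Int.emod_add_mul_ediv t q   -- t % q + q * (t / q) = t
    have h' : (b : ℤ) + (q : ℤ) * a = t := by rw [hbq, ha]; exact h
    have h'' : ((b : ℤ) : ℚ) + (q : ℚ) * (a : ℚ) = (t : ℚ) := by exact_mod_cast h'
    push_cast at h'' ⊢
    linarith
  have hstep : ∀ j ∈ Finset.range q, μ ((s + t + j) / q) = μ ((s + ((b + j : ℕ) : ℚ)) / q) := by
    intro j _
    refine hμ.eq_of_eq_add_int a ?_
    rw [htab]
    push_cast
    field_simp
    ring
  rw [Finset.sum_congr rfl hstep]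
  exact sum_range_comp_add_nat hμ hq b s

/-- **The double Hecke sum**: `∑_{j<q} ∑_{j'<q'} μ((r + j + q j')/(q q')) = ∑_{c<qq'} μ((r + c)/(q q'))`
(`(j, j') ↦ j + q j'` is a bijection `[0,q) × [0,q') → [0,qq')`). [folklore] -/
theorem sum_range_prod_eq (μ : ℚ → R) {q q' : ℕ} (hq : 0 < q) (r : ℚ) :
    ∑ j ∈ Finset.range q, ∑ j' ∈ Finset.range q', μ ((r + j + q * j') / (q * q')) =
      ∑ c ∈ Finset.range (q * q'), μ ((r + c) / (q * q')) := by
  rw [← Finset.sum_product']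
  refine Finset.sum_nbij' (fun x ↦ x.1 + q * x.2) (fun c ↦ (c % q, c / q)) ?_ ?_ ?_ ?_ ?_
  · intro x hx
    obtain ⟨h1, h2⟩ := Finset.mem_product.mp hx
    have h1' := Finset.mem_range.mp h1
    have h2' := Finset.mem_range.mp h2
    apply Finset.mem_range.mpr
    calc x.1 + q * x.2 < q + q * x.2 := by omega
      _ = q * (x.2 + 1) := by ring
      _ ≤ q * q' := Nat.mul_le_mul_left q h2'
  · intro c hc
    have hc' : c < q * q' := Finset.mem_range.mp hc
    refine Finset.mem_product.mpr ⟨Finset.mem_range.mpr (Nat.mod_lt _ hq), Finset.mem_range.mpr ?_⟩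
    exact Nat.div_lt_of_lt_mul hc'
  · intro x hx
    obtain ⟨h1, -⟩ := Finset.mem_product.mp hx
    have h1' := Finset.mem_range.mp h1
    ext
    · show (x.1 + q * x.2) % q = x.1
      rw [Nat.add_mul_mod_self_left, Nat.mod_eq_of_lt h1']
    · show (x.1 + q * x.2) / q = x.2
      rw [Nat.add_mul_div_left _ _ hq, Nat.div_eq_of_lt h1', zero_add]
  · intro c _
    show c % q + q * (c / q) = c
    exact Nat.mod_add_div c q
  · intro x _
    push_cast
    ring_nf

/-! ### §2 `H_q` preserves periodicity; `H_q` and `H_{q'}` commute -/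

/-- `H_q μ` is periodic when `μ` is (`q > 0`). [cite: MazurTateTeitelbaum1986Invent, §I.4 (4.2)] -/
theorem IsPeriodic.heckeTransform' (hμ : IsPeriodic μ) {q : ℕ} (hq : 0 < q) :
    IsPeriodic (heckeTransform q μ) := by
  intro r z
  have h1 : ∑ j ∈ Finset.range q, μ ((r + z + j) / q) = ∑ j ∈ Finset.range q, μ ((r + j) / q) :=
    sum_range_comp_add_int hμ hq z r
  have h2 : μ ((q : ℚ) * (r + z)) = μ ((q : ℚ) * r) :=
    hμ.eq_of_eq_add_int (q * z) (by push_cast; ring)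
  show (∑ j ∈ Finset.range q, μ ((r + z + j) / q)) + μ ((q : ℚ) * (r + z)) =
    (∑ j ∈ Finset.range q, μ ((r + j) / q)) + μ ((q : ℚ) * r)
  rw [h1, h2]

/-- **Closed form of `H_q (H_{q'} μ)`** for distinct primes `q, q'` and periodic `μ`:
`H_q(H_{q'}μ)(r) = ∑_{c<qq'} μ((r+c)/(qq')) + ∑_{j<q} μ((q' r + j)/q) + ∑_{j'<q'} μ((q r + j')/q') + μ(qq'r)`.
[cite: MazurTateTeitelbaum1986Invent, §I.4 (4.2)] -/
theorem heckeTransform_heckeTransform (hμ : IsPeriodic μ) {q q' : ℕ} (hq : q.Prime) (hq' : q'.Prime)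
    (hne : q ≠ q') (r : ℚ) :
    heckeTransform q (heckeTransform q' μ) r =
      (∑ c ∈ Finset.range (q * q'), μ ((r + c) / ((q * q' : ℕ) : ℚ))) +
        (∑ j ∈ Finset.range q, μ (((q' : ℚ) * r + j) / q)) +
        (∑ j' ∈ Finset.range q', μ (((q : ℚ) * r + j') / q')) + μ (((q * q' : ℕ) : ℚ) * r) := by
  have hqQ : (q : ℚ) ≠ 0 := by exact_mod_cast hq.ne_zero
  have hq'Q : (q' : ℚ) ≠ 0 := by exact_mod_cast hq'.ne_zero
  have hcop : q'.Coprime q := (Nat.coprime_primes hq' hq).mpr (Ne.symm hne)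
  -- unfold the outer and inner transforms
  have hout : heckeTransform q (heckeTransform q' μ) r =
      (∑ j ∈ Finset.range q, heckeTransform q' μ ((r + j) / q)) + heckeTransform q' μ ((q : ℚ) * r) := rfl
  have hin : ∀ s : ℚ, heckeTransform q' μ s = (∑ j' ∈ Finset.range q', μ ((s + j') / q')) + μ ((q' : ℚ) * s) :=
    fun s ↦ rfl
  rw [hout, hin]
  simp_rw [hin, Finset.sum_add_distrib]
  -- the four groups of terms
  have hA : ∑ j ∈ Finset.range q, ∑ j' ∈ Finset.range q', μ (((r + j) / q + j') / q') =
      ∑ c ∈ Finset.range (q * q'), μ ((r + c) / ((q * q' : ℕ) : ℚ)) := by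
    rw [Nat.cast_mul, ← sum_range_prod_eq μ hq.pos r]
    refine Finset.sum_congr rfl fun j _ ↦ Finset.sum_congr rfl fun j' _ ↦ ?_
    congr 1
    field_simp
  have hB : ∑ j ∈ Finset.range q, μ ((q' : ℚ) * ((r + j) / q)) =
      ∑ j ∈ Finset.range q, μ (((q' : ℚ) * r + j) / q) := by
    rw [← sum_range_comp_mul_mod hμ hq hcop ((q' : ℚ) * r)]
    refine Finset.sum_congr rfl fun j _ ↦ ?_
    congr 1
    field_simp
  have hD : μ ((q' : ℚ) * ((q : ℚ) * r)) = μ (((q * q' : ℕ) : ℚ) * r) := by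
    congr 1; push_cast; ring
  rw [hA, hB, hD]
  abel

/-- **`H_q` and `H_{q'}` COMMUTE on periodic functions** (distinct primes). [cite: MazurTateTeitelbaum1986Invent, §I.4 (4.2)] -/
theorem heckeTransform_comm (hμ : IsPeriodic μ) {q q' : ℕ} (hq : q.Prime) (hq' : q'.Prime)
    (hne : q ≠ q') (r : ℚ) :
    heckeTransform q (heckeTransform q' μ) r = heckeTransform q' (heckeTransform q μ) r := by
  rw [heckeTransform_heckeTransform hμ hq hq' hne r, heckeTransform_heckeTransform hμ hq' hq hne.symm r,
    mul_comm q' q]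
  abel

/-! ### §3 The Hecke derivative `d_q = H_q − 2` -/

/-- The **Hecke derivative** at `q`: `d_q μ = H_q μ − 2μ` (at a Kolyvagin prime, `a_q ≡ 2`, this is
`(T_q − a_q)μ`; `μ` is eigen iff `d_q μ = 0`). [cite: MazurTateTeitelbaum1986Invent, §I.4 (4.2)] -/
def heckeDeriv (q : ℕ) (μ : ℚ → R) : ℚ → R :=
  fun r ↦ heckeTransform q μ r - 2 * μ r

/-- The defining relation in the shape used by derivative families:
`H_q μ = 2μ + d_q μ`. [folklore] -/
theorem heckeTransform_eq_two_mul_add_heckeDeriv (q : ℕ) (μ : ℚ → R) (r : ℚ) :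
    heckeTransform q μ r = 2 * μ r + heckeDeriv q μ r := by
  simp only [heckeDeriv]
  ring

/-- `d_q μ` is periodic when `μ` is. [folklore] -/
theorem IsPeriodic.heckeDeriv (hμ : IsPeriodic μ) {q : ℕ} (hq : 0 < q) :
    IsPeriodic (heckeDeriv q μ) :=
  (hμ.heckeTransform' hq).sub (fun r z ↦ by simp only [hμ r z])

/-- `H_q` is `R`-linear for scalars: `H_q (c·μ) = c·H_q μ`. [folklore] -/
theorem heckeTransform_const_mul (q : ℕ) (c : R) (μ : ℚ → R) (r : ℚ) :
    heckeTransform q (fun x ↦ c * μ x) r = c * heckeTransform q μ r := by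
  simp only [LevelLowering.heckeTransform, mul_add, Finset.mul_sum]

/-- **The Hecke derivatives COMMUTE on periodic functions**: `d_q (d_{q'} μ) = d_{q'} (d_q μ)` for
distinct primes — so `d_U μ := (∏_{q∈U} d_q) μ` is well defined on finite sets `U` of primes, the shape
of the derivative families in `X4/KuriharaLevelLoweringDescentDefect.lean` and
`X4/KuriharaAdditiveLevelLowering.lean`. [cite: MazurTateTeitelbaum1986Invent, §I.4 (4.2)] -/
theorem heckeDeriv_comm (hμ : IsPeriodic μ) {q q' : ℕ} (hq : q.Prime) (hq' : q'.Prime)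
    (hne : q ≠ q') (r : ℚ) :
    heckeDeriv q (heckeDeriv q' μ) r = heckeDeriv q' (heckeDeriv q μ) r := by
  have key : ∀ (q₁ q₂ : ℕ) (s : ℚ), heckeTransform q₁ (heckeDeriv q₂ μ) s =
      heckeTransform q₁ (heckeTransform q₂ μ) s - 2 * heckeTransform q₁ μ s := by
    intro q₁ q₂ s
    have hfun : heckeDeriv q₂ μ = fun x ↦ heckeTransform q₂ μ x - (fun y ↦ 2 * μ y) x := rfl
    rw [hfun, heckeTransform_sub, heckeTransform_const_mul]
  have h1 : heckeDeriv q (heckeDeriv q' μ) r =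
      heckeTransform q (heckeDeriv q' μ) r - 2 * heckeDeriv q' μ r := rfl
  have h2 : heckeDeriv q' (heckeDeriv q μ) r =
      heckeTransform q' (heckeDeriv q μ) r - 2 * heckeDeriv q μ r := rfl
  rw [h1, h2, key, key]
  simp only [heckeDeriv]
  rw [heckeTransform_comm hμ hq hq' hne r]
  ring

end Summit.BirchSwinnertonDyer.Rank1Residual.LevelLowering

end
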